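import Literature.Computability.AlgebraicComplexity.TauConjectureValiant
import Literature.Computability.AlgebraicComplexity.KoiranCriterion
import HarnessLib

/-!
# Bürgisser's transfer theorem from three classical named facts

Final assembly for the named fact
`Literature.Computability.AlgebraicComplexity.not_isPBounded_constantFreeComplexity_perPoly_of_tauConjecture`
(`TauConjecture.lean`; Bürgisser, Comput. Complexity 18 (2009), Main Thm. 1.2 = ECCC TR06-113
Thm. 1.1(2) = STACS 2007 Thm. 1(2): the Shub–Smale τ-conjecture implies that `τ(PER_n)` is not
polynomially bounded). With Lemma 2.12 proved from Valiant's `#P`-hardness of the `0/1` permanent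
(`PermanentBitsPPoly.lean`) and the Thm. 2.11 application DISCHARGED (`KoiranCriterion.lean`,
`Burgisser2009_thm41_koiranStep_holds`), the target fact follows from exactly three named facts,
each a classical theorem of its own:

* `Burgisser2009_esymm_chDefinable` — Bürgisser's Cor. 3.9 (ECCC) = STACS Cor. of Thm. 14: the
  elementary symmetric functions `σ_k(1, …, n)` are definable in the counting hierarchy
  (iterated multiplication in `CH` via Dlogtime-uniform `TC⁰` arithmetic, Hesse–Allender–Barrington);
* `Valiant1979_per01Plain_isSharpPHardFun` — Valiant 1979: the `0/1` permanent is `#P`-hard;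
* `Burgisser2009_thm210` — Bürgisser's Thm. 2.10 (ECCC) = STACS Thm. 9 = Koiran 2004 Thm. 4.3 in
  `τ`-form: `τ(PER) = n^{O(1)} ⇒ τ(2^{p(n)} f_n) = n^{O(1)}` for `(f_n) ∈ VNP⁰` (the constant-free
  reading of Valiant's `VNP`-completeness of the permanent).

Everything else of the printed proof (Def. 3.1 bookkeeping, the coefficient reindexing, Lemma 2.5,
Lemma 2.12 from Valiant's theorem, Thm. 2.11 as applied, Thm. 4.1(2) with its sign gap, the root
count of `∏ (X - k)` and the growth argument) is proved in the tree.

## References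

* P. Bürgisser, Comput. Complexity 18 (2009) 81–103 = ECCC TR06-113; STACS 2007, LNCS 4393,
  pp. 133–144.
* L. G. Valiant, TCS 8 (1979) 189–201, Thm. 1.
* P. Koiran, Comput. Complexity 13 (2004) 131–146, Thm. 4.3, Thm. 6.1.
-/

namespace Literature.Computability.AlgebraicComplexity

/-- **Bürgisser's Thm. 4.1(2) (uniform form) from Valiant's theorem and Thm. 2.10 alone.** [cite: Burgisser2006, Thm. 4.1(2)] -/
theorem Burgisser2009_thm41_2_uniform_of_valiant_thm210 (hV : Valiant1979_per01Plain_isSharpPHardFun)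
    (h210 : Burgisser2009_thm210) : Burgisser2009_thm41_2_uniform :=
  Burgisser2009_thm41_2_uniform_of_valiant hV h210 Burgisser2009_thm41_koiranStep_holds

/-- **Bürgisser's transfer theorem from three classical named facts** — Cor. 3.9 (`σ_k(1,…,n)`
definable in `CH`), Valiant's `#P`-hardness of the `0/1` permanent, and Thm. 2.10 (constant-free
`VNP`-completeness of the permanent in `τ`-form): the Shub–Smale τ-conjecture implies that
`τ(PER_n)` is not polynomially bounded. [cite: Burgisser2009, Main Thm. 1.2] -/
theorem not_isPBounded_constantFreeComplexity_perPoly_of_tauConjecture_of_three_facts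
    (h39 : Burgisser2009_esymm_chDefinable) (hV : Valiant1979_per01Plain_isSharpPHardFun)
    (h210 : Burgisser2009_thm210) :
    not_isPBounded_constantFreeComplexity_perPoly_of_tauConjecture :=
  not_isPBounded_constantFreeComplexity_perPoly_of_tauConjecture_of_valiant h39 hV h210
    Burgisser2009_thm41_koiranStep_holds

end Literature.Computability.AlgebraicComplexity
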